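import Literature.NumberTheory.EllipticCurves.HuShuYin2019.SylvesterThreePart
import HarnessLib

/-!
# Shu–Yin 2022, Thm. 1.2: the `3`-part of BSD for the PRODUCTS `E_p × E_{3p²}` (`p ≡ 2 mod 9`) and `E_{p²} × E_{3p}` (`p ≡ 5 mod 9`) of cube-sum curves, and the COMBINATION with Burungale–Flach 2024 giving `BSD(E_{3p²}, 3)` / `BSD(E_{3p}, 3)` for the rank-one factor

HONEST FRAMING (cell `b2b-bsdres`, run/shared/lean/b2b/bsd-rank1-residual/; harvest seat
`b2b-bsdres-harvest-1`, gen 2): prove what is provable now; shrink each hard class to its core with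
data; no claim beyond stated classes. The cell deletes the COMBINATION-SHAPED residual classes of
the BSD formula in analytic rank `≤ 1` from PUBLISHED theorems only and TYPES the
construction-shaped ones; this is not "finishing BSD". This file vendors ONE published theorem
(named fact, nothing asserted; D-0014) — Shu–Yin's `3`-adic product formulas for a rank-zero and a
rank-one cube-sum curve — and PROVES the combination with Burungale–Flach 2024 (tree fact
`bsdTriple_of_hasCM_of_L_one_ne_zero`, through the proved step
`HuShuYin2019.bsdp_three_of_threePart_product`) isolating the rank-one factor. Census: the
RAMIFIED corner of the construction-shaped class X12 (CM by `ℚ(√-3)`, rank `1`, `p = 3 ∣ N`);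
reach of this file = the class **6075bc** (`E_15 = E_{3·5}`, `5 ≡ 5 mod 9`). FAMILY-shaped; the
label of X12 does not change. Companions: `KezukaLi2020/CubeSumThreePart.lean`,
`HuShuYin2019/SylvesterThreePart.lean`.

Source (arXiv text read this session, `paper:arxiv-1909.13800`, "Cube sums of form `3p` and `3p²`
II"; journal: J. Shu, H. Yin, *Cube sums of the forms `3p` and `3p²` II*, Math. Ann. 385 (2023),
no. 3-4, 1037–1060 (online 2022), doi:10.1007/s00208-022-02370-3 [ShuYin2022]).

* p. 1 (§1): "Let `E_n` be the elliptic curve given by `x³ + y³ = nz³`. It has the Weierstrass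
  equation `y² = x³ − 432n²`. If `n > 2` is not a cube, then `E_n(ℚ)_tor = 0` …"; "Since `2` is a
  cube sum, from now on, we may assume `p ≡ 2, 5 mod 9` is an odd prime number."; "let `Ш(E_n)`,
  `E_n(ℚ)_tor`, `Ω_n`, `R(E_n)` and `c_ℓ(E_n)` denote the Shafarevich-Tate group, the torsion
  subgroup, the minimal real period, the regulator and the Tamagawa number of `E_n` over `ℚ`
  respectively. Then the full BSD [formula] predicts that if `L(s,E)` is of order `r` at `s = 1`,
  then `|Ш(E_n)| = L^{(r)}(1,E_n)/(Ω_n · R(E_n)) · |E_n(ℚ)_tor|²/∏_ℓ c_ℓ(E_n)`. Let `P` (resp.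
  `Q`) be a generator of the free part of `E_{3p²}(ℚ)` (resp. `E_{3p}(ℚ)`)."
* **Theorem 1.1** (p. 1): "Let `p ≡ 2, 5 mod 9` be a prime. Then both `3p` and `3p²` are cube sums."
* **Theorem 1.2** (p. 1, VERBATIM): "Let `p ≡ 2 mod 9` be a rational prime number. Then
  `|Ш(E_p)|·|Ш(E_{3p²})| = L(1,E_p)/(Ω_p·ĥ_ℚ(P)) · L'(1,E_{3p²})/Ω_{3p²} · |E_p(ℚ)_tor|²/∏_ℓ c_ℓ(E_p)
  · |E_{3p²}(ℚ)_tor|²/∏_ℓ c_ℓ(E_{3p²})`, up to a power of `2p`.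
  Let `p ≡ 5 mod 9` be a rational prime number. Then `|Ш(E_{p²})|·|Ш(E_{3p})| =
  L(1,E_{p²})/(Ω_{p²}·ĥ_ℚ(Q)) · L'(1,E_{3p})/Ω_{3p} · |E_{p²}(ℚ)_tor|²/∏_ℓ c_ℓ(E_{p²}) ·
  |E_{3p}(ℚ)_tor|²/∏_ℓ c_ℓ(E_{3p})`, up to a power of `2p`."
* §5 (proof of Thm. 1.2, arXiv p. 10): Prop. 5.1 ("`dim_{𝔽₃} Sel₃(E_{3p²}(ℚ)) ≤ 1`,
  `dim_{𝔽₃} Sel₃(E_p(ℚ)) = 0`; `dim_{𝔽₃} Sel₃(E_{3p}(ℚ)) ≤ 1`, `dim_{𝔽₃} Sel₃(E_{p²}(ℚ)) = 0`",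
  from Satgé's `3`-isogeny Selmer groups and [HSY]); "By Proposition 5.1, `E_{3p²}(ℚ)` has rank
  `1`, and … we know directly that `|Ш(E_p)[3^∞]| = |Ш(E_{3p²})[3^∞]| = 1`"; "Note the RHS of (5.2)
  is a nonzero rational number"; the `3`-adic valuation of the right side is `0` by the explicit
  Gross–Zagier formula (Thm. 4.3/Cor. 4.4) and "`ĥ_ℚ(P) = u·ĥ_ℚ(z₃)` for some `u ∈ ℤ₃^× ∩ ℚ`"
  (Cor. 4.10); "One can verify (bsd2) in case `p ≡ 5 mod 9` similarly." Status: PUB (refereed).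

Transcription (tree dictionary as in the companion files; Miller's `#Ш_an = shaAn`,
`BSD(E,p) = BSDp`): case `p ≡ 2 mod 9`: `A` ≅ `E_p` (rank `0`), `B` ≅ `E_{3p²}` (rank `1`);
case `p ≡ 5 mod 9`: `A` ≅ `E_{p²}` (rank `0`), `B` ≅ `E_{3p}` (rank `1`); all globally minimal
models. Conclusions transcribed: `rk A = 0 = r_an(A)`, `rk B = 1 = r_an(B)` (the displays of
Thm. 1.2 instantiate the BSD prediction "if `L(s,E)` is of order `r`" with `r = 0` for the first
factor and `r = 1` — `L'` and the height of a generator — for the second; rank `1` and rank `0` by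
Prop. 5.1 / §5), `|Ш(A)[3^∞]| = |Ш(B)[3^∞]| = 1` (§5), and "up to a power of `2p`" read at the prime
`3 ≠ 2, p`: `#Ш_an(A) = q_A`, `#Ш_an(B) = q_B` rational, `q_B q_A ≠ 0`, `ord₃(q_B q_A) = 0`
(`= ord₃(|Ш(A)[3^∞]|·|Ш(B)[3^∞]|)`). Nothing weaker or stronger; `p = 2` excluded as printed. No
`_holds` expected; consumers take `(h : thm12_threePart_product)`. The COMBINATION with
Burungale–Flach (CM `A` with `L(A,1) ≠ 0`) is `HuShuYin2019.bsdp_three_of_threePart_product`.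

NOTE ON THE ANALYTIC RANKS (referee nit `sy22-ran-derived`, REFEREE.md F47, made explicit here;
no statement change): the clauses `r_an(A) = 0` and `r_an(B) = 1` of the transcription are NOT
sentences of Thm. 1.2 but one-line consequences of what is printed — the right side of (bsd1) /
(bsd2) "is a nonzero rational number" (§5), so `L(1,A) ≠ 0` (hence `r_an(A) = 0`) and `L'(1,B) ≠ 0`
(hence `r_an(B) ≤ 1`); and `rk B(ℚ) = 1` (Prop. 5.1 / §5) together with Gross–Zagier–Kolyvagin
(`r_an(B) = 0 ⇒ rk B(ℚ) = 0`) forces `L(1,B) = 0`, i.e. `r_an(B) = 1`. The two derived clauses are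
kept in the conclusion so that consumers need no separate analytic-rank input.

Census identification (Cremona `allcurves`, checked this session): `E_15 ≅ 6075bc2 =
[0,0,1,0,-1519]` (`64·(−1519) + 16 = −97200 = −432·15²`, `cremona_6075bc2_eq_cubeSumCurve`); the
census record `6075bc1 = [0,0,1,0,56]` is the `3`-isogenous curve (`Wuthrich2014.bsdp_of_isIsogenous`,
a lane step, as are global minimality of `6075bc2` and a globally minimal model of `E_25`).

## References
* [ShuYin2022] J. Shu, H. Yin, Math. Ann. 385 (2023) 1037–1060 = arXiv:1909.13800, Thm. 1.1, Thm. 1.2 (p. 1), §5 (Prop. 5.1, proof of Thm. 1.2), Cor. 4.4, Cor. 4.10.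
* [HuShuYin2019] Y. Hu, J. Shu, H. Yin, Trans. AMS 372 (2019) (SY's [HSY]; the model `y² = x³ − 432n²`).
* [BurungaleFlach2024] A. Burungale, M. Flach, Camb. J. Math. 12 (2024), Cor. 2 (tree `bsdTriple_of_hasCM_of_L_one_ne_zero`).
* [Miller2011LMS] R. L. Miller, LMS J. Comput. Math. 14 (2011), §1 and Def. 1.1; RESIDUAL-CASES.md §a.2 X12; HOME/b2b-bsdres-harvest-1/HARVEST.md row C14, RECLASSIFY.md (gen-2 addendum).
-/

noncomputable section

open scoped Classical

open WeierstrassCurve Literature.NumberTheory.EllipticCurves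
  Literature.NumberTheory.EllipticCurves.Rank1Residual
  Literature.NumberTheory.EllipticCurves.HuShuYin2019

namespace Literature.NumberTheory.EllipticCurves.ShuYin2022

/-- **Shu–Yin, Math. Ann. 385 (2023; online 2022), Thm. 1.2** (with Prop. 5.1/§5; verbatim in the
module docstring): for an odd prime `p ≡ 2 mod 9`, with `A ≅ E_p : y² = x³ − 432p²` (rank `0`) and
`B ≅ E_{3p²} : y² = x³ − 432(3p²)²` (rank `1`); resp. for an odd prime `p ≡ 5 mod 9`, with
`A ≅ E_{p²}` (rank `0`) and `B ≅ E_{3p}` (rank `1`): "`|Ш(A)|·|Ш(B)| = L(1,A)/Ω_A · L'(1,B)/(Ω_B ĥ(P))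
· |A(ℚ)_tor|²/∏c_ℓ(A) · |B(ℚ)_tor|²/∏c_ℓ(B)`, up to a power of `2p`", and (§5)
`|Ш(A)[3^∞]| = |Ш(B)[3^∞]| = 1`, `rk B = 1`, `rk A = 0`. Transcription: ranks and analytic ranks
`0`/`1` (the analytic ranks are a one-line CONSEQUENCE of the printed statements, not a sentence of
Thm. 1.2: right side nonzero ⇒ `L(1,A) ≠ 0`, `L'(1,B) ≠ 0`; `rk B = 1` + Gross–Zagier–Kolyvagin ⇒
`L(1,B) = 0` — see the module docstring note, referee nit `sy22-ran-derived`); `3`-primary parts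
trivial; `#Ш_an(A) = q_A`, `#Ш_an(B) = q_B` rational with `q_B q_A ≠ 0`
and `ord₃(q_B q_A) = 0`. FAMILY-shaped; census reach (with Burungale–Flach 2024,
`bsdp_three_of_thm12_five`): class 6075bc (`E_15`). STATUS PUB.
[cite: ShuYin2022, Thm. 1.2 (p. 1), Prop. 5.1 and proof of Thm. 1.2 (§5)] [cite: HuShuYin2019, p. 4 (the model)] [cite: Miller2011LMS, §1 and Def. 1.1] -/
def thm12_threePart_product : Prop :=
  ∀ (p : ℕ), p.Prime → p ≠ 2 →
    (p % 9 = 2 →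
      ∀ (A B : WeierstrassCurve ℚ) [A.IsElliptic] [A.IsGloballyMinimal]
        [B.IsElliptic] [B.IsGloballyMinimal],
        (∃ C : VariableChange ℚ, C • A = cubeSumCurve (p : ℚ)) →
        (∃ C : VariableChange ℚ, C • B = cubeSumCurve (3 * (p : ℚ) ^ 2)) →
        A.mordellWeilRank = 0 ∧ A.analyticRank = 0 ∧ B.mordellWeilRank = 1 ∧ B.analyticRank = 1 ∧
        Nat.card (AddCommGroup.primaryComponent A.sha 3) = 1 ∧
        Nat.card (AddCommGroup.primaryComponent B.sha 3) = 1 ∧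
        ∃ qB qA : ℚ, shaAn B = (qB : ℂ) ∧ shaAn A = (qA : ℂ) ∧ qB * qA ≠ 0 ∧
          padicValRat 3 (qB * qA) = 0) ∧
    (p % 9 = 5 →
      ∀ (A B : WeierstrassCurve ℚ) [A.IsElliptic] [A.IsGloballyMinimal]
        [B.IsElliptic] [B.IsGloballyMinimal],
        (∃ C : VariableChange ℚ, C • A = cubeSumCurve ((p : ℚ) ^ 2)) →
        (∃ C : VariableChange ℚ, C • B = cubeSumCurve (3 * (p : ℚ))) →
        A.mordellWeilRank = 0 ∧ A.analyticRank = 0 ∧ B.mordellWeilRank = 1 ∧ B.analyticRank = 1 ∧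
        Nat.card (AddCommGroup.primaryComponent A.sha 3) = 1 ∧
        Nat.card (AddCommGroup.primaryComponent B.sha 3) = 1 ∧
        ∃ qB qA : ℚ, shaAn B = (qB : ℂ) ∧ shaAn A = (qA : ℂ) ∧ qB * qA ≠ 0 ∧
          padicValRat 3 (qB * qA) = 0)

/-- **Thm. 1.2 (`p ≡ 2 mod 9`) + Burungale–Flach 2024 ⇒ `BSD(E_{3p²}, 3)`** for the rank-one
cube-sum curve `E_{3p²}`, for any globally minimal `B ≅ E_{3p²}`, given a globally minimal
`A ≅ E_p` (lane certificate). Standing named facts: `hCM0` (Burungale–Flach Cor. 2, tree form),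
`hmod` (modularity). [cite: ShuYin2022, Thm. 1.2 (p. 1)] [cite: BurungaleFlach2024, Cor. 2] [cite: Miller2011LMS, Def. 1.1] -/
theorem bsdp_three_of_thm12_two (h : thm12_threePart_product)
    (hCM0 : bsdTriple_of_hasCM_of_L_one_ne_zero) (hmod : hasEntireLFunction_rat)
    {p : ℕ} (hp : p.Prime) (hp2 : p ≠ 2) (h9 : p % 9 = 2)
    (A B : WeierstrassCurve ℚ) [A.IsElliptic] [A.IsGloballyMinimal] [B.IsElliptic]
    [B.IsGloballyMinimal] (hA : ∃ C : VariableChange ℚ, C • A = cubeSumCurve (p : ℚ))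
    (hB : ∃ C : VariableChange ℚ, C • B = cubeSumCurve (3 * (p : ℚ) ^ 2)) :
    B.analyticRank = 1 ∧ BSDp B 3 := by
  obtain ⟨-, hA0, hrk, hr, hAtriv, hBtriv, qB, qA, hqB, hqA, hne, hv⟩ :=
    (h p hp hp2).1 h9 A B hA hB
  have hBfin : Finite (AddCommGroup.primaryComponent B.sha 3) :=
    Nat.finite_of_card_ne_zero (by rw [hBtriv]; exact one_ne_zero)
  exact ⟨hr, bsdp_three_of_threePart_product hCM0 hmod A B (hasCM_of_variableChange_eq hA) hA0
    (by rw [hrk, hr]) hAtriv hBfin hBtriv hqA hqB hne hv⟩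

/-- **Thm. 1.2 (`p ≡ 5 mod 9`) + Burungale–Flach 2024 ⇒ `BSD(E_{3p}, 3)`** for the rank-one
cube-sum curve `E_{3p}`, for any globally minimal `B ≅ E_{3p}`, given a globally minimal
`A ≅ E_{p²}`. Census: class 6075bc (`p = 5`, `E_15`).
[cite: ShuYin2022, Thm. 1.2 (p. 1)] [cite: BurungaleFlach2024, Cor. 2] [cite: Miller2011LMS, Def. 1.1] -/
theorem bsdp_three_of_thm12_five (h : thm12_threePart_product)
    (hCM0 : bsdTriple_of_hasCM_of_L_one_ne_zero) (hmod : hasEntireLFunction_rat)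
    {p : ℕ} (hp : p.Prime) (h9 : p % 9 = 5)
    (A B : WeierstrassCurve ℚ) [A.IsElliptic] [A.IsGloballyMinimal] [B.IsElliptic]
    [B.IsGloballyMinimal] (hA : ∃ C : VariableChange ℚ, C • A = cubeSumCurve ((p : ℚ) ^ 2))
    (hB : ∃ C : VariableChange ℚ, C • B = cubeSumCurve (3 * (p : ℚ))) :
    B.analyticRank = 1 ∧ BSDp B 3 := by
  have hp2 : p ≠ 2 := by rintro rfl; norm_num at h9
  obtain ⟨-, hA0, hrk, hr, hAtriv, hBtriv, qB, qA, hqB, hqA, hne, hv⟩ :=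
    (h p hp hp2).2 h9 A B hA hB
  have hBfin : Finite (AddCommGroup.primaryComponent B.sha 3) :=
    Nat.finite_of_card_ne_zero (by rw [hBtriv]; exact one_ne_zero)
  exact ⟨hr, bsdp_three_of_threePart_product hCM0 hmod A B (hasCM_of_variableChange_eq hA) hA0
    (by rw [hrk, hr]) hAtriv hBfin hBtriv hqA hqB hne hv⟩

/-- Census identification: Cremona `6075bc2 = [0,0,1,0,-1519]` is `ℚ`-isomorphic to
`E_15 : y² = x³ − 432·15²` by `(x, y) ↦ (x/4, y/8 − 1/2)` (`HuShuYin2019.halfScale`).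
[folklore] -/
theorem cremona_6075bc2_eq_cubeSumCurve :
    halfScale • (⟨0, 0, 1, 0, -1519⟩ : WeierstrassCurve ℚ) = cubeSumCurve (3 * (5 : ℚ)) := by
  rw [halfScale_smul]
  simp only [cubeSumCurve]
  norm_num

end Literature.NumberTheory.EllipticCurves.ShuYin2022
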